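import Mathlib
import Summits.Ventures.PercRepro.TriangleCapRowA2Five

/-!
# PercRepro — THE STABILITY TABLE ON EVERY CELL `r ≤ a + 2` OF EVERY ROW `5 ≤ a ≤ 18`, IN ONE STATEMENT, AND THE
SECOND-BEST VALUE OF THE CHERRY TABLE ON EVERY CELL `3 ≤ r ≤ a + 2` (p3, gen 48; part 201d)

`stabGapTwo k a r`: `2 (k − 2a − 1)(a − r)` for `r ≤ a − 3`, `2 (k − 2a − 1)` for `r ∈ {a − 2, a − 1}`, `2 (k − a − 3)`
at `r = a`, `2k − 10` at `r = a + 1`, `min (2k + 2a − 14) (2k + 4a − 26)` at `r = a + 2` (the triple broom for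
`a ≥ 6`, the one-triangle family at `a = 5`). `stab_table_two`: on the cell `(k, a, r)`, `5 ≤ a ≤ 18`, `r ≤ a + 2`,
`3a + 2 ≤ k`, the non-`a`-bipartite second best is EXACTLY `closed − stabGapTwo k a r`. `second_best_A1_cell` /
`cherry_second_best_two`: the second-best value of the cherry table is `closed − 2 (r − 2)` on every cell
`3 ≤ r ≤ a + 2` (the brooms of the `a`-side). Axioms: standard.
-/

namespace PercRepro

namespace TriangleCap

namespace C047

open Finset

/-- The non-bipartite gap of the stability table on the cells `r ≤ a + 2`. -/
def stabGapTwo (k a r : ℕ) : ℕ :=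
  if r + 3 ≤ a then 2 * (k - 2 * a - 1) * (a - r)
  else if r + 1 ≤ a then 2 * (k - 2 * a - 1)
  else if r = a then 2 * (k - a - 3)
  else if r = a + 1 then 2 * k - 10
  else min (2 * k + 2 * a - 14) (2 * k + 4 * a - 26)

/-- On the cells `r ≤ a + 1` the new gap is the old one. -/
theorem stabGapTwo_eq_stabGapAll (k a r : ℕ) (hr : r ≤ a + 1) : stabGapTwo k a r = stabGapAll k a r := by
  unfold stabGapTwo stabGapAll
  by_cases h3 : r + 3 ≤ a
  · rw [if_pos h3, if_pos h3]
  · by_cases h1 : r + 1 ≤ a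
    · rw [if_neg h3, if_pos h1, if_neg h3, if_pos h1]
    · by_cases h0 : r = a
      · rw [if_neg h3, if_neg h1, if_pos h0, if_neg h3, if_neg h1, if_pos h0]
      · have h2 : r = a + 1 := by omega
        rw [if_neg h3, if_neg h1, if_neg h0, if_pos h2, if_neg h3, if_neg h1, if_neg h0]

/-- **THE NON-BIPARTITE STABILITY TABLE ON EVERY CELL `r ≤ a + 2` OF EVERY ROW `5 ≤ a ≤ 18`**, `3a + 2 ≤ k`: every
non-`a`-bipartite `K₄⁻`-free graph on `Fin k` with `a (k − a) − r` edges has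
`Σ_v d(v)² + r (k − 1 − r) + stabGapTwo k a r ≤ m k`, and the value is attained by a non-`a`-bipartite graph. -/
theorem stab_table_two (k a r : ℕ) (ha5 : 5 ≤ a) (ha18 : a ≤ 18) (hr : r ≤ a + 2) (hk : 3 * a + 2 ≤ k) :
    (∀ (D : SimpleGraph (Fin k)) [DecidableRel D.Adj], K4mFree D → D.edgeFinset.card + r = a * (k - a) →
        (¬ ∃ A : Finset (Fin k), A.card = a ∧ BipSub D A) →
        ∑ v, deg D v * deg D v + r * (k - 1 - r) + stabGapTwo k a r ≤ D.edgeFinset.card * k) ∧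
      ∃ (D : SimpleGraph (Fin k)) (_ : DecidableRel D.Adj), K4mFree D ∧ D.edgeFinset.card + r = a * (k - a) ∧
        (¬ ∃ A : Finset (Fin k), A.card = a ∧ BipSub D A) ∧
        ∑ v, deg D v * deg D v + r * (k - 1 - r) + stabGapTwo k a r = D.edgeFinset.card * k := by
  rcases Nat.lt_or_ge r (a + 2) with hra | hra
  · rw [stabGapTwo_eq_stabGapAll k a r (by omega)]
    exact stab_table_all'' k a r (by omega) ha18 (by omega) (by omega)
  · have hr' : r = a + 2 := by omega
    subst hr'
    have hgap : stabGapTwo k a (a + 2) = min (2 * k + 2 * a - 14) (2 * k + 4 * a - 26) := by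
      unfold stabGapTwo
      have h3 : ¬ (a + 2 + 3 ≤ a) := by omega
      have h1 : ¬ (a + 2 + 1 ≤ a) := by omega
      have h0 : ¬ (a + 2 = a) := by omega
      have h2 : ¬ (a + 2 = a + 1) := by omega
      rw [if_neg h3, if_neg h1, if_neg h0, if_neg h2]
    rw [hgap]
    exact rowA2_nonbip_second_best_min k a ha5 ha18 hk

/-- **THE SECOND-BEST VALUE OF THE CHERRY TABLE ON THE CELL `(k, a, a + 1)`, `5 ≤ a ≤ 18`, `3a + 1 ≤ k`:**
`closed − 2 (a − 1)` (the brooms of the `a`-side): the `a`-bipartite graphs are `≥ 2 (a − 1)` below unless they miss a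
star (then extremal), the others `≥ 2k − 10 ≥ 2 (a − 1)` below. -/
theorem second_best_A1_cell (k a : ℕ) (ha5 : 5 ≤ a) (ha18 : a ≤ 18) (hk : 3 * a + 1 ≤ k) :
    (∀ (D : SimpleGraph (Fin k)) [DecidableRel D.Adj], K4mFree D → D.edgeFinset.card + (a + 1) = a * (k - a) →
        ∑ v, deg D v * deg D v + (a + 1) * (k - 1 - (a + 1)) ≠ D.edgeFinset.card * k →
        ∑ v, deg D v * deg D v + (a + 1) * (k - 1 - (a + 1)) + 2 * (a - 1) ≤ D.edgeFinset.card * k) ∧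
      ∃ (D : SimpleGraph (Fin k)) (_ : DecidableRel D.Adj), K4mFree D ∧ D.edgeFinset.card + (a + 1) = a * (k - a) ∧
        ∑ v, deg D v * deg D v + (a + 1) * (k - 1 - (a + 1)) + 2 * (a - 1) = D.edgeFinset.card * k := by
  have hcard : Fintype.card (Fin k) = k := Fintype.card_fin k
  refine ⟨?_, ?_⟩
  · intro D _ hK hm hne
    rcases rowA1_second_order_gen'' D hK a ha5 ha18 (by rw [hcard]; exact hk) (by rw [hcard]; exact hm)
      with ⟨A, hAcard, hB⟩ | h
    · by_cases hstar : ∃ v, MissingStar D A v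
      · obtain ⟨v, hv⟩ := hstar
        have h := closed_form_eq_of_missingStar D A hB hv a (a + 1) hAcard (by rw [hcard]; exact hm)
          (by rw [hcard]; omega)
        rw [hcard] at h
        exact absurd h hne
      · have h := closed_form_stability_bipSub D A hB a (a + 1) hAcard (by rw [hcard]; exact hm)
          (by rw [hcard]; omega) (by omega) hstar
        rw [hcard] at h
        have e : 2 * (a + 1 - 2) = 2 * (a - 1) := by omega
        rw [e] at h
        exact h
    · rw [hcard] at h
      omega
  · obtain ⟨D, inst, A, hK, hAcard, hB, hns, hE, hS⟩ := broom_value k a (a + 1) (by omega) (by omega) (by omega)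
    have hr' : a + 1 ≤ a * (k - a) := by
      have h1 : 2 ≤ k - a := by omega
      have h2 : a * 2 ≤ a * (k - a) := Nat.mul_le_mul_left a h1
      omega
    have hE' : D.edgeFinset.card + (a + 1) = a * (k - a) := by rw [hE]; omega
    refine ⟨D, inst, hK, hE', ?_⟩
    rw [hE]
    have e : 2 * (a + 1 - 2) = 2 * (a - 1) := by omega
    rw [e] at hS
    exact hS

/-- **THE SECOND-BEST VALUE OF THE CHERRY TABLE ON EVERY CELL `3 ≤ r ≤ a + 2` OF EVERY ROW `5 ≤ a ≤ 18`**,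
`3a + 2 ≤ k`: `closed − 2 (r − 2)`, the brooms of the `a`-side. -/
theorem cherry_second_best_two (k a r : ℕ) (ha5 : 5 ≤ a) (ha18 : a ≤ 18) (hr3 : 3 ≤ r) (hr : r ≤ a + 2)
    (hk : 3 * a + 2 ≤ k) :
    (∀ (D : SimpleGraph (Fin k)) [DecidableRel D.Adj], K4mFree D → D.edgeFinset.card + r = a * (k - a) →
        ∑ v, deg D v * deg D v + r * (k - 1 - r) ≠ D.edgeFinset.card * k →
        ∑ v, deg D v * deg D v + r * (k - 1 - r) + 2 * (r - 2) ≤ D.edgeFinset.card * k) ∧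
      ∃ (D : SimpleGraph (Fin k)) (_ : DecidableRel D.Adj), K4mFree D ∧ D.edgeFinset.card + r = a * (k - a) ∧
        ∑ v, deg D v * deg D v + r * (k - 1 - r) + 2 * (r - 2) = D.edgeFinset.card * k := by
  rcases Nat.lt_or_ge r a with hra | hra
  · exact cherry_second_best_table k a r (by omega) ha18 hr3 (by omega) (by omega)
  · rcases Nat.lt_or_ge r (a + 1) with hra1 | hra1
    · have hr' : r = a := by omega
      subst hr'
      exact second_best_A_cell k r (by omega) ha18 (by omega)
    · rcases Nat.lt_or_ge r (a + 2) with hra2 | hra2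
      · have hr' : r = a + 1 := by omega
        subst hr'
        have e : a + 1 - 2 = a - 1 := by omega
        rw [e]
        exact second_best_A1_cell k a (by omega) ha18 (by omega)
      · have hr' : r = a + 2 := by omega
        subst hr'
        have e : a + 2 - 2 = a := by omega
        rw [e]
        exact second_best_A2_cell' k a ha5 ha18 hk

end C047

end TriangleCap

end PercRepro
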